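import Summits.Ventures.PercRepro.GenQProfileFacts

/-!
# PercRepro — the SHIFTED trace sum in the profile (night-4, gen 8)

The trace sum of a set with a coloop `a` is the trace sum of the set without `a` with the weights shifted to
`1/(3 + m)` (`traceSum_insert_eq_shifted`, GenQTraceTopColoop).  For the certificate generator the shifted sum at
level `L` on a rank-`q` set `H`, times `L + 1`, is written in the profile `#Pc k m` exactly as
`traceSum_mul_succ_eq_profile` writes the unshifted one:
`(L+1)·TS'_t = (L+2)·DF_t + Σ_{k ≤ d} Σ_m #Pc k m · ((L+1)(L+2−t)/(3+m) − (L+2))` (`traceSumShift_mul_eq_profile`).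
-/
namespace PercRepro.Night4

open Finset ThmH SixFour GenQ PerFlat Star

variable {α : Type*} [DecidableEq α] {M : Matroid α} [M.Finite]

/-- **The shifted trace sum at level `L`, type `t`, times `L + 1`, in the profile.** -/
theorem traceSumShift_mul_eq_profile {H : Finset α} {q d : ℕ} (hH : H ⊆ gr M)
    (hrH : M.eRk (H : Set α) = (q : ℕ∞)) (hcard : H.card = q + d) (L t : ℕ) :
    ((L : ℚ) + 1) * ∑ B ∈ Rq M H q, (((L : ℚ) + 2 - t) * (1 / (3 + (mTr M B : ℚ))) -
        (((L : ℚ) + 2) / ((L : ℚ) + 1)) * GenQ.dem M H t B) =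
      ((L : ℚ) + 2) * (DFq M H q t : ℚ) + ∑ k ∈ Finset.range (d + 1), ∑ m ∈ Finset.Icc (mTr M H) q,
        ((Pc M H q k m).card : ℚ) * (((L : ℚ) + 1) * ((L : ℚ) + 2 - t) / (3 + (m : ℚ)) - ((L : ℚ) + 2)) := by
  have h1 := sum_Rq_eq_sum_Pc hH hrH hcard
    (fun _ m => ((L : ℚ) + 1) * ((L : ℚ) + 2 - t) / (3 + (m : ℚ)) - ((L : ℚ) + 2))
  rw [← h1]
  have hpos : (0 : ℚ) < (L : ℚ) + 1 := by positivity
  have hdem : ∑ B ∈ Rq M H q, (((L : ℚ) + 2) / ((L : ℚ) + 1)) * GenQ.dem M H t B =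
      (((L : ℚ) + 2) / ((L : ℚ) + 1)) * ((Nq M H q : ℚ) - (DFq M H q t : ℚ)) := by
    rw [← Finset.mul_sum, sum_dem_eq']
  have hN : (Nq M H q : ℚ) = ∑ B ∈ Rq M H q, (1 : ℚ) := by
    unfold Nq
    rw [Finset.card_eq_sum_ones]
    push_cast
    rfl
  have hs3 : ∑ S ∈ Rq M H q, (((L : ℚ) + 1) * ((L : ℚ) + 2 - t) / (3 + (mTr M S : ℚ)) - ((L : ℚ) + 2)) =
      ((L : ℚ) + 1) * ∑ B ∈ Rq M H q, ((((L : ℚ) + 2 - t) * (1 / (3 + (mTr M B : ℚ))))) -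
        ((L : ℚ) + 2) * ∑ B ∈ Rq M H q, (1 : ℚ) := by
    rw [Finset.mul_sum, Finset.mul_sum, ← Finset.sum_sub_distrib]
    apply Finset.sum_congr rfl
    intro S _
    ring
  rw [Finset.sum_sub_distrib, hdem, hN, hs3, mul_sub]
  field_simp
  ring

end PercRepro.Night4
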